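import Summits.BirchSwinnertonDyer.BirchSwinnertonDyer.Theorems.AdditiveKolyvaginRoadToricLocalDefs
import Summits.BirchSwinnertonDyer.BirchSwinnertonDyer.Theorems.AdditiveKolyvaginRoadToricIsotropy
import HarnessLib

/-!
# Route `AdditiveKolyvaginRoad`, crux `KolyvaginPrimitiveAdditive` (item stmt-BirchSwinnertonDyer-20132), stub LOC,
# towards (Supply) at a general prime `p` — (Lag-tor), dictionary clause: `x ∈ toricLocalKer ⟺ res x ∈ toricLocalCondition`
# (toric companion of §1 of koly3b's `…ZhangSupplyOrdinaryLagrangian`)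
# (cell `pub/bsd-wall`, lead prover `bsd-wall-akr-p1` g3; `--supports stmt-BirchSwinnertonDyer-20132`, helper)

WHY THIS FILE. The unsigned ∕ signed jump of the GLOBAL half of (Supply) asks above every level prime for a LOCAL
condition `Ltor v` with the one-sided dictionary `loc⁻¹(Ltor v) ⊆ toricLocalKer` (binder `hordIncl` of koly3b's
`hjump_of_localLagrangians`, ordinary ↦ toric). With `Ltor v := AdditiveKoly.toricLocalCondition` (p550390) this file
proves the dictionary in both directions: the forward direction is akr-p1 g2's
`exists_valued_cocycle_of_mem_toricLocalKer` (p-generic companion of koly g13), the converse is koly3b's argument with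
fixed points ↦ augmentation subgroup (`θ = torsionPointsEquiv` is `Γ_L`-equivariant, so it maps the augmentation
subgroup of `Γ_L` on `E[n](K̄)` onto the augmentation subgroup on `E(K̄_L)[n]`).

WHAT. `torsionPointsEquiv_mem_augmentationPoints`, `mem_toricLocalKer_of_res_mem_toricLocalCondition`,
`mem_toricLocalKer_iff_res_mem_toricLocalCondition`.

HONEST FRAMING: theorems only; 0 definitions, 0 named facts, 0 `sorry`; closes nothing.

References: [cite: BertoliniDarmon2005, §2.2–§2.3 (H¹_ord)] [cite: WZhang2014, §4.1] [cite: SilvermanAEC2009, Cor. III.6.4(b)].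
-/

-- single-conjunct summit: `Summit.BirchSwinnertonDyer.BirchSwinnertonDyer.…` repeats the name by design
set_option linter.dupNamespace false

noncomputable section

open scoped Classical

universe u

namespace Summit.BirchSwinnertonDyer.BirchSwinnertonDyer.Theorems.AdditiveKoly

open CategoryTheory WeierstrassCurve Field Function NumberField IsDedekindDomain
open Literature.NumberTheory.EllipticCurves Literature.NumberTheory.GaloisRepresentations
open scoped ContRepresentation

section Dictionary

variable {K : Type u} [Field K] [NumberField K] (E : WeierstrassCurve K) (n : ℕ) [NeZero n] [E.IsElliptic]
variable (L : Type u) [Field L] [Algebra K L]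

omit [NeZero n] in
/-- The torsion comparison `θ = torsionPointsEquiv` maps the augmentation subgroup `⟨res τ • y − y⟩` of `Γ_L` on
`E[n](K̄)` into the augmentation subgroup `⟨τ • z − z⟩` on `E(K̄_L)[n]` (`θ (res τ • y) = τ • θ y`). [folklore] -/
theorem torsionPointsEquiv_mem_augmentationPoints (hn : (n : ℤ) ≠ 0) (m : geomTorsion E n)
    (hm : m ∈ AddSubgroup.closure {m : geomTorsion E n |
      ∃ (τ : absoluteGaloisGroup L) (y : geomTorsion E n), m = absGaloisRestrict K L τ • y - y}) :
    E.torsionPointsEquiv (n : ℤ) (E := L) hn m ∈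
      augmentationPoints (absoluteGaloisGroup L) (AddSubgroup.torsionBy (localPoints E L) (n : ℤ)) := by
  unfold augmentationPoints
  have key : AddSubgroup.closure {m : geomTorsion E n |
        ∃ (τ : absoluteGaloisGroup L) (y : geomTorsion E n), m = absGaloisRestrict K L τ • y - y} ≤
      (AddSubgroup.closure {z : AddSubgroup.torsionBy (localPoints E L) (n : ℤ) |
        ∃ (g : absoluteGaloisGroup L) (x : AddSubgroup.torsionBy (localPoints E L) (n : ℤ)), z = g • x - x}).comap
        (E.torsionPointsEquiv (n : ℤ) (E := L) hn).toAddMonoidHom := by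
    refine (AddSubgroup.closure_le _).mpr fun m' hm' ↦ ?_
    obtain ⟨τ, y, rfl⟩ := hm'
    rw [SetLike.mem_coe, AddSubgroup.mem_comap]
    change E.torsionPointsEquiv (n : ℤ) (E := L) hn (absGaloisRestrict K L τ • y - y) ∈ _
    rw [map_sub, ← resGal_eq_absGaloisRestrict, torsionPointsEquiv_smul]
    exact AddSubgroup.subset_closure ⟨τ, _, rfl⟩
  exact key hm

/-- **`res_L x ∈ toricLocalCondition ⟹ x ∈ toricLocalKer`**: if the restriction of `x = [φ]` is the class of an
augmentation-valued cocycle `ψ`, `φ ∘ res − ψ = ∂m`, then the localisation `torsionLocMap x = [θ ∘ φ ∘ res]` is the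
class of the augmentation-valued cocycle `θ ∘ ψ` (`θ = torsionPointsEquiv`, equivariant), the difference being `∂(θ m)`
(koly3b's `mem_ordinaryLocalKer_of_res_mem_ordinaryLocalCondition`, fixed points ↦ augmentation subgroup).
[cite: BertoliniDarmon2005, §2.2–§2.3 (H¹_ord)] [cite: SilvermanAEC2009, Cor. III.6.4(b)] -/
theorem mem_toricLocalKer_of_res_mem_toricLocalCondition {x : galH1Torsion E (n : ℤ)}
    (hx : galoisCohomology.res (E.torsionGaloisModule n) L 1 x ∈ toricLocalCondition E L (n : ℤ)) :
    x ∈ toricLocalKer E L (n : ℤ) := by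
  have hn : (n : ℤ) ≠ 0 := by exact_mod_cast NeZero.ne n
  obtain ⟨φ, rfl⟩ := oneCocycleClass_surjective (discreteTopRep (absoluteGaloisGroup K) (geomTorsion E n)) x
  obtain ⟨ψ, hψval, hψ⟩ := hx
  -- `ψ - φ ∘ res = ∂ m`
  rw [res_torsionGaloisModule_oneCocycleClass, ← sub_eq_zero, ← oneCocycleClass_sub, oneCocycleClass_eq_zero_iff]
    at hψ
  obtain ⟨m, hm⟩ := hψ
  have hm' : ∀ σ : absoluteGaloisGroup L, ψ.1 σ - φ.1 (absGaloisRestrict K L σ) = absGaloisRestrict K L σ • m - m :=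
    fun σ ↦ hm σ
  set θ := E.torsionPointsEquiv (n : ℤ) (E := L) hn with hθ
  -- the augmentation-valued local cocycle `θ ∘ ψ`
  have hcoc : ∀ g h : absoluteGaloisGroup L, ψ.1 (g * h) = ψ.1 g + absGaloisRestrict K L g • ψ.1 h :=
    fun g h ↦ ψ.2 g h
  let ψ' : contOneCocycles (discreteTopRep (absoluteGaloisGroup L)
      (AddSubgroup.torsionBy (localPoints E L) (n : ℤ))) :=
    ⟨⟨fun σ ↦ θ (ψ.1 σ), continuous_of_discreteTopology.comp ψ.1.continuous⟩, fun g h ↦ by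
      change θ (ψ.1 (g * h)) = θ (ψ.1 g) + g • θ (ψ.1 h)
      rw [hcoc g h, map_add, hθ, ← torsionPointsEquiv_smul, resGal_eq_absGaloisRestrict]⟩
  have hψ' : ∀ σ, ψ'.1 σ = θ (ψ.1 σ) := fun σ ↦ rfl
  -- unfold the toric kernel
  change oneCocycleClass _ φ ∈ AddSubgroup.comap _ _
  rw [AddSubgroup.mem_comap]
  refine ⟨ψ', fun σ ↦ ?_, ?_⟩
  · -- values lie in the augmentation subgroup
    rw [hψ', hθ]
    exact torsionPointsEquiv_mem_augmentationPoints E n L hn _ (hψval σ)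
  · -- the class: `torsionLocMap [φ] = [θ ∘ φ ∘ res] = [ψ']`
    have hloc : E.torsionLocMap L (n : ℤ)
          (oneCocycleClass (discreteTopRep (absoluteGaloisGroup K) (geomTorsion E n)) φ) =
        oneCocycleClass (discreteTopRep (absoluteGaloisGroup L)
            (AddSubgroup.torsionBy (localPoints E L) (n : ℤ)))
          (contOneCocycles.pullback (resGal (K := K) L)
            (resHomOfEquivariant (resGal (K := K) L)
              (torsionPointsMap E L n) (torsionPointsMap_smul E L n)) φ) :=
      map_oneCocycleClass _ _ _ φ
    rw [hloc, ← sub_eq_zero, ← oneCocycleClass_sub, oneCocycleClass_eq_zero_iff]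
    refine ⟨θ m, fun g ↦ ?_⟩
    change θ (ψ.1 g) - torsionPointsMap E L n (φ.1 (resGal (K := K) L g)) = g • θ m - θ m
    rw [resGal_eq_absGaloisRestrict, hθ, ← torsionPointsEquiv_apply E (n : ℤ) hn, ← map_sub, hm',
      map_sub, ← resGal_eq_absGaloisRestrict, torsionPointsEquiv_smul]

/-- **`x ∈ toricLocalKer ⟺ res_L x ∈ toricLocalCondition`** (akr-p1 g2's forward direction
`exists_valued_cocycle_of_mem_toricLocalKer` + the converse above): the dictionary clause of (Lag-tor) for
`Ltor v := toricLocalCondition`. [cite: BertoliniDarmon2005, §2.2–§2.3 (H¹_ord)] -/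
theorem mem_toricLocalKer_iff_res_mem_toricLocalCondition (x : galH1Torsion E (n : ℤ)) :
    x ∈ toricLocalKer E L (n : ℤ) ↔
      galoisCohomology.res (E.torsionGaloisModule n) L 1 x ∈ toricLocalCondition E L (n : ℤ) := by
  refine ⟨fun hx ↦ ?_, mem_toricLocalKer_of_res_mem_toricLocalCondition E n L⟩
  obtain ⟨ψ, hψ, h⟩ := exists_valued_cocycle_of_mem_toricLocalKer E n L hx
  exact ⟨ψ, hψ, h⟩

end Dictionary

end Summit.BirchSwinnertonDyer.BirchSwinnertonDyer.Theorems.AdditiveKoly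

end
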